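import Summits.ResolutionOfSingularities.ResolutionOfSingularities.Theorems.FrobeniusLadderFRationalResolutionDualLatticeBasis
import Mathlib.Algebra.BigOperators.Group.Finset.Basic
import HarnessLib

/-!
# Crux `FrobeniusLadder.FRationalResolution` (stmt-ResolutionOfSingularities-15317), line `redirect`,
# stub `stub_diagonalizableQuotientResolution` — the dual lattice OF THE WEIGHTS has a ℤ-basis (lane W‴, brick T0 in weight form)

`…DualLatticeBasis.exists_linearEquiv_mem_iff_latticeN` (brick T0) produces the coordinate change `φ` for an abstract ℤ-submodule
`N` with `ℤⁿ ⊆ N`, `d • N ⊆ ℤⁿ`. Lane W‴ (`…SubstitutionSafeRays`, `…SafeLadder`) writes the dual lattice of the weights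
`c : Fin n → A` as the PREDICATE "`⟨m, v⟩ ∈ ℤ` for every integer exponent `m` of weight `0`". This file packages the predicate
as a ℤ-submodule inside the proof and delivers `φ` in exactly the form of hypothesis `hφ` of
`…SafeLadder.exists_equivariant_projective_ladder_safe` (✓ p831580), for a weight group killed by `d > 0` (e.g. `d = |A|`).

* `pairing_single` — `⟨m, e_l⟩ = m_l`; `pairing_add`, `pairing_zsmul` — additivity of the pairing in `v`;
* **`exists_linearEquiv_dualLattice`** — `∃ φ : ℚⁿ ≃ₗ ℚⁿ, ∀ v, (v ∈ N_c) ↔ φ v ∈ ℤⁿ`.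

Honest label: linear algebra bookkeeping for the DESIGN W‴. No stub closed by name. No definitions, no named facts, no sorry.
[folklore; cite: Fulton1993Toric, §2.1 p. 29]
-/

-- single-problem summit: the doubled namespace component is forced
set_option linter.dupNamespace false

namespace Summit.ResolutionOfSingularities.ResolutionOfSingularities.Theorems.FRationalResolution.DualLatticeWeights

open Literature.Geometry.PolyhedralFans
open Summit.ResolutionOfSingularities.ResolutionOfSingularities.Theorems.FRationalResolution.DualLatticeBasis

variable {n : ℕ} {A : Type} [AddCommGroup A]

/-- The pairing of an integer exponent with a coordinate vector: `⟨m, e_l⟩ = m_l`. [folklore] -/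
theorem pairing_single (m : Fin n → ℤ) (l : Fin n) :
    ∑ l', (m l' : ℚ) * (Pi.single l (1 : ℚ) : Fin n → ℚ) l' = m l := by
  classical
  simp only [Pi.single_apply, mul_ite, mul_one, mul_zero, Finset.sum_ite_eq', Finset.mem_univ, if_true]

/-- **The dual lattice of the weights has a ℤ-basis (brick T0, weight form).** Let `c : Fin n → A` be weights in an abelian
group killed by `d > 0`. Then there is a `ℚ`-linear automorphism `φ` of `ℚⁿ` such that, for every `v`, `⟨m, v⟩ ∈ ℤ` for all
integer exponents `m` of weight `0` if and only if `φ v ∈ ℤⁿ`. [folklore; cite: Fulton1993Toric, §2.1 p. 29] -/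
theorem exists_linearEquiv_dualLattice (c : Fin n → A) (d : ℕ) (hd : 0 < d) (hdA : ∀ a : A, d • a = 0) :
    ∃ φ : (Fin n → ℚ) ≃ₗ[ℚ] (Fin n → ℚ), ∀ v : Fin n → ℚ,
      (∀ m : Fin n → ℤ, ∑ l, m l • c l = 0 → ∃ z : ℤ, ∑ l, (m l : ℚ) * v l = z) ↔ φ v ∈ latticeN (Fin n) := by
  classical
  -- the dual lattice as a ℤ-submodule
  let N : Submodule ℤ (Fin n → ℚ) :=
    { carrier := {v | ∀ m : Fin n → ℤ, ∑ l, m l • c l = 0 → ∃ z : ℤ, ∑ l, (m l : ℚ) * v l = z}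
      add_mem' := by
        intro v w hv hw m hm
        obtain ⟨z₁, hz₁⟩ := hv m hm
        obtain ⟨z₂, hz₂⟩ := hw m hm
        refine ⟨z₁ + z₂, ?_⟩
        simp only [Pi.add_apply, mul_add, Finset.sum_add_distrib, hz₁, hz₂, Int.cast_add]
      zero_mem' := by
        intro m _
        exact ⟨0, by simp⟩
      smul_mem' := by
        intro k v hv m hm
        obtain ⟨z, hz⟩ := hv m hm
        refine ⟨k * z, ?_⟩
        simp only [Pi.smul_apply, zsmul_eq_mul, Int.cast_mul]
        rw [← hz, Finset.mul_sum]
        exact Finset.sum_congr rfl fun l _ => by ring }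
  have hmem : ∀ v, v ∈ N ↔ ∀ m : Fin n → ℤ, ∑ l, m l • c l = 0 → ∃ z : ℤ, ∑ l, (m l : ℚ) * v l = z :=
    fun v => Iff.rfl
  -- coordinate vectors belong to `N`
  have hsub : ∀ l : Fin n, (Pi.single l (1 : ℚ) : Fin n → ℚ) ∈ N := by
    intro l
    rw [hmem]
    intro m _
    exact ⟨m l, pairing_single m l⟩
  -- `d • N ⊆ ℤⁿ`: pair with the weight-`0` exponent `d e_l`
  have hN : ∀ v ∈ N, ((d : ℚ) • v) ∈ latticeN (Fin n) := by
    intro v hv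
    rw [mem_latticeN_iff]
    intro l
    have hw : ∑ l', (fun l' => if l' = l then (d : ℤ) else 0) l' • c l' = 0 := by
      simp only [ite_smul, zero_smul, Finset.sum_ite_eq', Finset.mem_univ, if_true, natCast_zsmul]
      exact hdA (c l)
    obtain ⟨z, hz⟩ := (hmem v).1 hv _ hw
    refine ⟨z, ?_⟩
    rw [← hz]
    simp only [Pi.smul_apply, smul_eq_mul, Int.cast_ite, Int.cast_natCast, Int.cast_zero, ite_mul, zero_mul,
      Finset.sum_ite_eq', Finset.mem_univ, if_true]
  obtain ⟨φ, hφ⟩ := exists_linearEquiv_mem_iff_latticeN N hsub d hd hN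
  exact ⟨φ, fun v => (hmem v).symm.trans (hφ v)⟩

end Summit.ResolutionOfSingularities.ResolutionOfSingularities.Theorems.FRationalResolution.DualLatticeWeights
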